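import Literature.AnabelianGeometry.SemiGraphs.ArithMaximalCompact
import Mathlib.Algebra.Group.PUnit
import Mathlib.Analysis.SpecificLimits.Basic
import HarnessLib

/-!
# [SemiAnbd] §5 (Def 5.3, Rmk 5.3.1, Thm 5.4 (i)(ii)) as FACT-LIST rows: kernel closure census of
# `IsArithAmple` (F-1401), `IntersectionWithGeometricStatement` (F-1400),
# `ArithMaximalCompactStatementI` (F-1398), `ArithMaximalCompactStatementII` (F-1399)

Mochizuki, *Semi-graphs of anabelioids*, Publ. RIMS **42** (2006), §5, Def. 5.3 / Rmk. 5.3.1 (p. 65)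
and Thm. 5.4 (i), (ii) (p. 66) of the author's manuscript [cite: MochizukiSemiAnbd2006, Def 5.3, p. 65].
abc-iut cell, D-0078 fact-proving wave, tranche 156 of `plan/F-TRANCHES.tsv` (seat abc-iut-w5-d095,
gen 4); PROOF-ONLY companion of `ArithMaximalCompact.lean` (abc-iut-L3-t3), which is PURE GROUP THEORY
over Mathlib: every printed assertion is a `Prop`-valued predicate ON EXPLICIT DATA — a topological
group `Gtp` (for `Π^temp_𝔊`), `PA` (for `Π_A`), `aug : Gtp →* PA`, and a `DecompositionData` of chosen
decomposition groups — and the trunk file says so ("predicates, not closed named facts").  No definition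
of the trunk file is edited or restated.

WHAT IS RECORDED IN THE KERNEL (numbers, not opinions).

* F-1401 `IsArithAmple aug K` (Def 5.3 (i), first clause) is a DEFINITION: its universal closure is
  FALSE (`not_forall_isArithAmple`: the trivial subgroup of `ℝ` does not have open image under the
  identity) and it is inhabited (`isArithAmple_top_of_surjective`: a surjective augmentation makes `⊤`
  ample) — cf. the tree's general `not_isArithAmple_bot` (`ArithNotAmpleBot.lean`, non-discrete `Π_A`)
  and `IsArithAmple.mono` (`ArithMaximalCompactReductions.lean`), not restated here.
* F-1400 `IntersectionWithGeometricStatement D aug IsGeomVerticial IsGeomEdgeLike` (Rmk 5.3.1, second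
  sentence) quantifies over the two FREE predicates "verticial / edge-like subgroup of `Π^temp_𝔾` in the
  sense of Thm 3.7": closure FALSE (`not_forall_intersectionWithGeometricStatement`: one vertex and the
  predicate `False`), inhabited (`intersectionWithGeometricStatement_of_top`: the predicates `True`).
* F-1398 `ArithMaximalCompactStatementI D aug` (Thm 5.4 (i)) and F-1399 `ArithMaximalCompactStatementII
  D aug` (Thm 5.4 (ii)): closures FALSE over decomposition data WITHOUT VERTICES (the compact, ample
  trivial subgroup of the trivial group lies in no verticial subgroup; it is arithmetically maximal
  compact but not verticial) — `not_forall_arithMaximalCompactStatementI/II`; both inhabited by the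
  one-vertex, edge-free decomposition data of the trivial group (`exists_arithMaximalCompactStatements_toy`, built inline — no definition is
  introduced).
* The GENUINE instance forms live in the L3 companion files and are not restated here:
  `arithMaximalCompactStatementI_of_levelData` (`ArithCompactInVerticialConj2.lean`),
  `arithMaximalCompactStatementII_of_representatives`, `ArithChartAction.isArithAmple_arithVertGp`
  (`ArithChartActionAmple.lean`), `ArithEdgeLikeInfVerticial.lean` (consumers of F-1400 by name).

FACT-LIST reading: F-1398/F-1399/F-1400/F-1401 = «universal closure REFUTED / schema over explicit data;
instance forms inhabited (toy here; genuine = the L3 level-data theorems above)».  Classical bookkeeping;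
nothing of [SemiAnbd] is asserted or denied; no side taken on [IUTchIII] Cor. 3.12; typed ≠ proved.
-/

namespace Literature.AnabelianGeometry.SemiGraphs

open Topology Filter

universe u u' w w'

/-! ### F-1401 `IsArithAmple` (Def 5.3 (i), first clause) -/

section Ample

variable {Gtp : Type u} [Group Gtp] {PA : Type u'} [Group PA] [TopologicalSpace PA]

/-- If the augmentation `Π^temp_𝔊 ↠ Π_A` is surjective, the whole group is arithmetically ample (its
image `Π_A` is open). [cite: MochizukiSemiAnbd2006, Def 5.3 (i), p. 65] -/
theorem isArithAmple_top_of_surjective {aug : Gtp →* PA} (h : Function.Surjective aug) :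
    IsArithAmple aug ⊤ := by
  unfold IsArithAmple
  rw [Subgroup.map_top_of_surjective aug h]
  exact isOpen_univ

/-- In `ℝ` (written multiplicatively) the trivial subgroup is NOT arithmetically ample for the identity
augmentation: `{0}` is not open in `ℝ`. [cite: MochizukiSemiAnbd2006, Def 5.3 (i), p. 65] -/
theorem not_isArithAmple_bot_real :
    ¬ IsArithAmple (MonoidHom.id (Multiplicative ℝ)) (⊥ : Subgroup (Multiplicative ℝ)) := by
  unfold IsArithAmple
  rw [Subgroup.map_bot, Subgroup.coe_bot]
  intro h
  have h' : IsOpen ({(0 : ℝ)} : Set ℝ) := h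
  exact (inferInstance : Filter.NeBot (𝓝[≠] (0 : ℝ))).ne
    ((isOpen_singleton_iff_punctured_nhds (0 : ℝ)).mp h')

/-- **F-1401 is a definition (predicate): its universal closure is FALSE.**
[cite: MochizukiSemiAnbd2006, Def 5.3 (i), p. 65] -/
theorem not_forall_isArithAmple :
    ¬ ∀ (Gtp : Type) (_ : Group Gtp) (PA : Type) (_ : Group PA) (_ : TopologicalSpace PA)
        (aug : Gtp →* PA) (K : Subgroup Gtp), IsArithAmple aug K :=
  fun h => not_isArithAmple_bot_real (h _ _ _ _ _ _ _)

/-- … and it is inhabited (e.g. `⊤` for the identity of the trivial group).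
[cite: MochizukiSemiAnbd2006, Def 5.3 (i), p. 65] -/
theorem isArithAmple_top_punit : IsArithAmple (MonoidHom.id PUnit.{1}) ⊤ :=
  isArithAmple_top_of_surjective Function.surjective_id

end Ample

/-! ### Toy decomposition data over the trivial group -/

section Toy

/-- Every subgroup of the trivial group is `⊤`. [folklore] -/
private theorem subgroup_punit_eq_top (K : Subgroup PUnit.{1}) : K = ⊤ :=
  Subgroup.ext fun x => ⟨fun _ => trivial, fun _ => Subsingleton.elim (1 : PUnit) x ▸ K.one_mem⟩

/-- Conjugating a subgroup of the trivial group does nothing. [folklore] -/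
private theorem conjSubgroup_punit (g : PUnit.{1}) (K : Subgroup PUnit.{1}) : conjSubgroup g K = K := by
  rw [subgroup_punit_eq_top (conjSubgroup g K), subgroup_punit_eq_top K]

/-- In the trivial group every subgroup is arithmetically maximal compact for the identity
augmentation (compact: a subsingleton; ample: `Π_A` discrete; maximal: all subgroups coincide).
[cite: MochizukiSemiAnbd2006, Def 5.3 (i), p. 65] -/
theorem isArithMaximalCompact_punit (K : Subgroup PUnit.{1}) :
    IsArithMaximalCompact (MonoidHom.id PUnit.{1}) K := by
  refine ⟨Set.subsingleton_of_subsingleton.isCompact, isOpen_discrete _, fun K' _ _ _ => ?_⟩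
  rw [subgroup_punit_eq_top K, subgroup_punit_eq_top K']

end Toy

/-! ### F-1400 `IntersectionWithGeometricStatement` (Rmk 5.3.1, second sentence) -/

section Intersection

variable {Gtp : Type u} [Group Gtp] {PA : Type u'} [Group PA] {V : Type w} {B : Type w'}

/-- With the geometric predicates `True`, the intersection statement holds for ANY data (the row
quantifies over FREE predicates `IsGeomVerticial`, `IsGeomEdgeLike` — the Thm 3.7 notions enter as
parameters). [cite: MochizukiSemiAnbd2006, Rmk 5.3.1, p. 65] -/
theorem intersectionWithGeometricStatement_of_top (D : DecompositionData Gtp V B) (aug : Gtp →* PA) :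
    IntersectionWithGeometricStatement D aug (fun _ => True) (fun _ => True) :=
  ⟨fun _ _ => trivial, fun _ _ => trivial⟩

/-- With a vertex present and the geometric-verticial predicate `False`, the intersection statement
FAILS (the chosen decomposition group of the vertex is verticial). [cite: MochizukiSemiAnbd2006, Rmk 5.3.1, p. 65] -/
theorem not_intersectionWithGeometricStatement_of_bot (D : DecompositionData Gtp V B) (aug : Gtp →* PA)
    (v : V) (Q : Subgroup Gtp → Prop) :
    ¬ IntersectionWithGeometricStatement D aug (fun _ => False) Q := fun h =>
  h.1 (conjSubgroup 1 (D.vertGp v)) ⟨v, 1, rfl⟩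

/-- **F-1400 quantifies over free predicates: its universal closure is FALSE** (one vertex, trivial
group, `IsGeomVerticial := False`). [cite: MochizukiSemiAnbd2006, Rmk 5.3.1, p. 65] -/
theorem not_forall_intersectionWithGeometricStatement :
    ¬ ∀ (Gtp : Type) (_ : Group Gtp) (PA : Type) (_ : Group PA) (V B : Type)
        (D : DecompositionData Gtp V B) (aug : Gtp →* PA) (P Q : Subgroup Gtp → Prop),
        IntersectionWithGeometricStatement D aug P Q := fun h =>
  not_intersectionWithGeometricStatement_of_bot (Gtp := PUnit.{1}) (PA := PUnit.{1}) (B := PEmpty.{1})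
    { E := PEmpty.{1}, edgeOf := fun b => b.elim, abut := fun b => b.elim, vertGp := fun _ => ⊤,
      brGp := fun b => b.elim, brGp_le_vertGp := fun b => b.elim }
    (MonoidHom.id _) () (fun _ => False) (h _ _ _ _ _ _ _ _ _ _)

end Intersection

/-! ### F-1398 / F-1399 `ArithMaximalCompactStatementI/II` (Thm 5.4 (i), (ii)) -/

section Statements

variable {Gtp : Type u} [Group Gtp] [TopologicalSpace Gtp] {PA : Type u'} [Group PA]
  [TopologicalSpace PA] {V : Type w} {B : Type w'}

/-- Over decomposition data WITHOUT VERTICES, Thm 5.4 (i) as typed fails as soon as some compact,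
arithmetically ample subgroup exists (it lies in no verticial subgroup).
[cite: MochizukiSemiAnbd2006, Thm 5.4 (i), p. 66] -/
theorem not_arithMaximalCompactStatementI_of_isEmpty [IsEmpty V] (D : DecompositionData Gtp V B)
    (aug : Gtp →* PA) (K : Subgroup Gtp) (hc : IsCompact (K : Set Gtp)) (ha : IsArithAmple aug K) :
    ¬ ArithMaximalCompactStatementI D aug := fun h => by
  obtain ⟨⟨W, ⟨v, _, _⟩, _⟩, -⟩ := h K hc ha
  exact isEmptyElim v

/-- Over decomposition data WITHOUT VERTICES, Thm 5.4 (ii) as typed fails as soon as some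
arithmetically maximal compact subgroup exists (it is not verticial).
[cite: MochizukiSemiAnbd2006, Thm 5.4 (ii), p. 66] -/
theorem not_arithMaximalCompactStatementII_of_isEmpty [IsEmpty V] (D : DecompositionData Gtp V B)
    (aug : Gtp →* PA) (K : Subgroup Gtp) (hK : IsArithMaximalCompact aug K) :
    ¬ ArithMaximalCompactStatementII D aug := fun h => by
  obtain ⟨v, _, _⟩ := (h.1 K).mp hK
  exact isEmptyElim v

/-- **F-1398 is a statement about explicit data: its universal closure is FALSE** (trivial group, no
vertices: the compact ample subgroup `⊤` lies in no verticial subgroup).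
[cite: MochizukiSemiAnbd2006, Thm 5.4 (i), p. 66] -/
theorem not_forall_arithMaximalCompactStatementI :
    ¬ ∀ (Gtp : Type) (_ : Group Gtp) (_ : TopologicalSpace Gtp) (PA : Type) (_ : Group PA)
        (_ : TopologicalSpace PA) (V B : Type) (D : DecompositionData Gtp V B) (aug : Gtp →* PA),
        ArithMaximalCompactStatementI D aug := fun h =>
  not_arithMaximalCompactStatementI_of_isEmpty
    ({ E := PEmpty.{1}, edgeOf := fun b => b.elim, abut := fun b => b.elim, vertGp := fun v => v.elim,
       brGp := fun b => b.elim, brGp_le_vertGp := fun b => b.elim } :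
      DecompositionData PUnit.{1} PEmpty.{1} PEmpty.{1})
    (MonoidHom.id PUnit.{1}) ⊤ (isArithMaximalCompact_punit ⊤).1 (isArithMaximalCompact_punit ⊤).2.1
    (h _ _ _ _ _ _ _ _ _ _)

/-- **F-1399 is a statement about explicit data: its universal closure is FALSE** (trivial group, no
vertices: `⊤` is arithmetically maximal compact but not verticial).
[cite: MochizukiSemiAnbd2006, Thm 5.4 (ii), p. 66] -/
theorem not_forall_arithMaximalCompactStatementII :
    ¬ ∀ (Gtp : Type) (_ : Group Gtp) (_ : TopologicalSpace Gtp) (PA : Type) (_ : Group PA)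
        (_ : TopologicalSpace PA) (V B : Type) (D : DecompositionData Gtp V B) (aug : Gtp →* PA),
        ArithMaximalCompactStatementII D aug := fun h =>
  not_arithMaximalCompactStatementII_of_isEmpty
    ({ E := PEmpty.{1}, edgeOf := fun b => b.elim, abut := fun b => b.elim, vertGp := fun v => v.elim,
       brGp := fun b => b.elim, brGp_le_vertGp := fun b => b.elim } :
      DecompositionData PUnit.{1} PEmpty.{1} PEmpty.{1})
    (MonoidHom.id PUnit.{1}) ⊤ (isArithMaximalCompact_punit ⊤) (h _ _ _ _ _ _ _ _ _ _)

/-- **Thm 5.4 (i) and (ii) hold for toy data** over the trivial group (one vertex with vertex group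
`⊤`, no edges; data built inline, no definition introduced): every subgroup lies in the unique
verticial subgroup; every subgroup is both arithmetically maximal compact and verticial; no two
maximal compact subgroups are distinct and no subgroup is edge-like.
[cite: MochizukiSemiAnbd2006, Thm 5.4, p. 66] -/
theorem exists_arithMaximalCompactStatements_toy :
    ∃ D : DecompositionData PUnit.{1} PUnit.{1} PEmpty.{1},
      ArithMaximalCompactStatementI D (MonoidHom.id PUnit.{1}) ∧
        ArithMaximalCompactStatementII D (MonoidHom.id PUnit.{1}) := by
  refine ⟨{ E := PEmpty.{1}, edgeOf := fun b => b.elim, abut := fun b => b.elim, vertGp := fun _ => ⊤,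
            brGp := fun b => b.elim, brGp_le_vertGp := fun b => b.elim }, ?_, ?_⟩
  · intro K _ _
    refine ⟨⟨⊤, ⟨PUnit.unit, 1, (conjSubgroup_punit 1 ⊤).symm⟩, le_top⟩, fun W₁ W₂ _ _ hne => ?_⟩
    exact absurd ((subgroup_punit_eq_top W₁).trans (subgroup_punit_eq_top W₂).symm) hne
  · refine ⟨fun K => ⟨fun _ => ⟨PUnit.unit, 1, ?_⟩, fun _ => isArithMaximalCompact_punit K⟩,
      fun K => ⟨?_, ?_⟩⟩
    · rw [conjSubgroup_punit]
      exact subgroup_punit_eq_top K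
    · rintro ⟨-, M₁, M₂, -, -, hne, -⟩
      exact absurd ((subgroup_punit_eq_top M₁).trans (subgroup_punit_eq_top M₂).symm) hne
    · rintro ⟨b, -, -⟩
      exact b.elim

/-- Summary: over explicit data both truth values of Thm 5.4 (i)/(ii)-as-typed occur already for the
trivial group (one vertex: true; no vertex: false) — the rows are hypothesis schemata whose genuine
instances are the L3 level-data theorems (`arithMaximalCompactStatementI_of_levelData`,
`arithMaximalCompactStatementII_of_representatives`). [cite: MochizukiSemiAnbd2006, Thm 5.4, p. 66] -/
theorem arithMaximalCompactStatements_both_ways :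
    (∃ (V B : Type) (D : DecompositionData PUnit.{1} V B),
        ArithMaximalCompactStatementI D (MonoidHom.id PUnit.{1}) ∧
          ArithMaximalCompactStatementII D (MonoidHom.id PUnit.{1})) ∧
      ∃ (V B : Type) (D : DecompositionData PUnit.{1} V B),
        ¬ ArithMaximalCompactStatementI D (MonoidHom.id PUnit.{1}) ∧
          ¬ ArithMaximalCompactStatementII D (MonoidHom.id PUnit.{1}) := by
  refine ⟨?_, PEmpty.{1}, PEmpty.{1},
    { E := PEmpty.{1}, edgeOf := fun b => b.elim, abut := fun b => b.elim, vertGp := fun v => v.elim,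
      brGp := fun b => b.elim, brGp_le_vertGp := fun b => b.elim }, ?_, ?_⟩
  · obtain ⟨D, h⟩ := exists_arithMaximalCompactStatements_toy
    exact ⟨_, _, D, h⟩
  · exact not_arithMaximalCompactStatementI_of_isEmpty _ _ ⊤ (isArithMaximalCompact_punit ⊤).1
      (isArithMaximalCompact_punit ⊤).2.1
  · exact not_arithMaximalCompactStatementII_of_isEmpty _ _ ⊤ (isArithMaximalCompact_punit ⊤)

end Statements

end Literature.AnabelianGeometry.SemiGraphs
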